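import Summits.SmoothPoincare4.SmoothPoincare4.Theses.SullivanDual
import Literature.Geometry.Symplectic.TamingWitness
import Literature.Geometry.Symplectic.GromovR4StdModel
import Literature.Geometry.Symplectic.SteinBall
import Literature.Topology.FourManifolds.InvertedGermExtension

/-!
# SmoothPoincare4 / SullivanDual — crux `Target` (stmt-SmoothPoincare4-7823), line `Sketch`:
# the collar lemma (registered stub `stub_collar`)

Route SullivanDual reaches its target `Target` ("some smooth `J` on `Σ ∖ p` has no taming
witness at any small radius") through the reduction "closed-EXACT taming kills witnesses":
if `J` is standard on a punctured chart-ball at `p` and `dγ` tames `J` for a smooth `1`-form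
`γ`, then `J` has no taming witness (`Literature.Geometry.Symplectic.TamingWitness`) below the
standardness radius.  This file proves the heart of that reduction, the **collar lemma**
`stub_collar`: a taming witness `T` at radius `ε` does not charge the region where `J` is
standard — it kills every smooth `2`-form supported in the punctured `ε₃`-ball (`ε < ε₃ < ε'`),
GIVEN a "collar form" `ω̃` (smooth, closed, standard on `B_ε`, `J`-non-negative, uniformly
`J`-positive on `B_{ε₃}`; constructed in the companion file from a flat cut-off of `dλ₀`) and
chart-norm bounds for smooth `2`-forms on the compact collar.

Ingredients, all elementary: (W1)-closure by scaling (`tamingWitness_nonneg_of_forall_nonneg`: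
`T ≥ 0` on smooth forms that are `J`-non-negative off the ball, as soon as one taming form
exists), domination (`tamingWitness_eq_zero_of_dominated`), `T ω̃ = 0` from (W3) and
(W1)-closure, and the flat identities `‖Dι(y) u‖ = ‖u‖ / ‖y‖²` (the derivative of the
inversion is `‖y‖⁻²` times a reflection), `A (J v) = J₀ (A v)` for `J` standard
(`A = Dι ∘ De`), `‖J₀ a‖ = ‖a‖`.

References: D. Sullivan, *Cycles for the dynamical study of foliated manifolds and complex
manifolds*, Invent. Math. 36 (1976), Thm. I.7 [Sullivan1976]; M. Gromov, *Pseudo holomorphic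
curves in symplectic manifolds*, Invent. Math. 82 (1985), §0.3.C [Gromov1985].
-/

noncomputable section

-- the registered namespace `Summit.SmoothPoincare4.SmoothPoincare4.Theorems` repeats a component
set_option linter.dupNamespace false

open scoped Manifold ContDiff Topology InnerProductSpace
open Set Filter Metric
open Literature.Geometry.Kaehler Literature.Geometry.Symplectic

namespace Summit.SmoothPoincare4.SmoothPoincare4.Theorems

namespace SullivanDual

/-! ### §1 Flat identities: the inversion and the standard structures of `ℝ⁴ = ℂ²` -/

/-- `‖Dι(y) u‖ = ‖u‖ / ‖y‖²` for the inversion `ι z = z/‖z‖²` at `y ≠ 0`: its derivative is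
`‖y‖⁻²` times a reflection (Mathlib's `EuclideanGeometry.hasFDerivAt_inversion`). [folklore] -/
theorem norm_fderiv_inversion_apply {y : EuclideanSpace ℝ (Fin 4)} (hy : y ≠ 0)
    (u : EuclideanSpace ℝ (Fin 4)) :
    ‖fderiv ℝ inversion y u‖ = ‖u‖ / ‖y‖ ^ 2 := by
  have hfun : (inversion : EuclideanSpace ℝ (Fin 4) → EuclideanSpace ℝ (Fin 4)) =
      EuclideanGeometry.inversion (0 : EuclideanSpace ℝ (Fin 4)) 1 := by
    rw [show (inversion : EuclideanSpace ℝ (Fin 4) → EuclideanSpace ℝ (Fin 4)) =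
        Literature.Topology.FourManifolds.sphereInversion from funext inversion_eq_sphereInversion]
    exact Literature.Topology.FourManifolds.sphereInversion.eq_inversion
  have hd := EuclideanGeometry.hasFDerivAt_inversion (c := (0 : EuclideanSpace ℝ (Fin 4)))
    (R := (1 : ℝ)) hy
  rw [hfun, hd.fderiv, _root_.smul_apply, norm_smul, sub_zero, dist_zero_right,
    Real.norm_of_nonneg (by positivity)]
  have hr : ‖((ℝ ∙ y)ᗮ.reflection : EuclideanSpace ℝ (Fin 4) →L[ℝ] EuclideanSpace ℝ (Fin 4)) u‖ =
      ‖u‖ := ((ℝ ∙ y)ᗮ.reflection).norm_map u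
  rw [hr]
  field_simp

/-- `‖J₀ a‖ = ‖a‖`: the standard complex structure of `ℝ⁴ = ℂ²` is an isometry. [folklore] -/
theorem norm_stdComplexStructure (a : EuclideanSpace ℝ (Fin 4)) :
    ‖stdComplexStructure a‖ = ‖a‖ := by
  have h := inner_stdComplexStructure_stdComplexStructure a a
  rw [real_inner_self_eq_norm_sq, real_inner_self_eq_norm_sq] at h
  exact (sq_eq_sq₀ (norm_nonneg _) (norm_nonneg _)).1 h

/-- `⟪J₀ a, b⟫ = ω₀(a, b)` (the Euclidean metric relates `J₀` and `ω₀`). [folklore] -/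
theorem inner_stdComplexStructure_eq_stdSymplecticForm' (a b : EuclideanSpace ℝ (Fin 4)) :
    ⟪stdComplexStructure a, b⟫_ℝ = stdSymplecticForm a b := by
  rw [Literature.Topology.FourManifolds.inner_fin_four]
  simp only [stdComplexStructure_apply_zero, stdComplexStructure_apply_one,
    stdComplexStructure_apply_two, stdComplexStructure_apply_three, stdSymplecticForm]
  ring

/-- A vector `u` with `⟪u, b⟫ = ω₀(a, b)` for all `b` is `J₀ a`. [folklore] -/
theorem eq_stdComplexStructure_of_inner_eq {u a : EuclideanSpace ℝ (Fin 4)}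
    (h : ∀ b, ⟪u, b⟫_ℝ = stdSymplecticForm a b) : u = stdComplexStructure a := by
  refine ext_inner_right ℝ fun b => ?_
  rw [h b, inner_stdComplexStructure_eq_stdSymplecticForm']

/-- `ω₀(a, J₀ a) = ‖a‖²`. [folklore] -/
theorem stdSymplecticForm_stdComplexStructure_self (a : EuclideanSpace ℝ (Fin 4)) :
    stdSymplecticForm a (stdComplexStructure a) = ‖a‖ ^ 2 := by
  rw [← inner_stdComplexStructure_eq_stdSymplecticForm', real_inner_self_eq_norm_sq,
    norm_stdComplexStructure]

/-! ### §2 Witness algebra: consequences of (W1) by scaling -/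

section WitnessAlgebra

variable {M : Type*} [TopologicalSpace M] [ChartedSpace (EuclideanSpace ℝ (Fin 4)) M] [T1Space M]
  {p : M} {ε : ℝ}
  {J : ∀ x : punctured p, TangentSpace (𝓡 4) x →L[ℝ] TangentSpace (𝓡 4) x}
  {T : MForm (𝓡 4) (punctured p) ℝ 2 →ₗ[ℝ] ℝ}

/-- **(W1)-closure.** If some smooth form `β₀` tames `J` off the ball, a taming witness is
NON-NEGATIVE on every smooth form `β` that is `J`-non-negative off the ball
(`β_x(v, Jv) ≥ 0` for `x ∉ B_ε`): `β + t β₀` tames `J` off the ball for every `t > 0`, so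
`T β + t T β₀ > 0` for all `t > 0`. [folklore] -/
theorem tamingWitness_nonneg_of_forall_nonneg (h : TamingWitness p ε J T)
    {β₀ : MForm (𝓡 4) (punctured p) ℝ 2} (hβ₀ : IsSmoothForm β₀) (hβ₀t : TamesOffBall p ε J β₀)
    {β : MForm (𝓡 4) (punctured p) ℝ 2} (hβ : IsSmoothForm β)
    (hnn : ∀ x : punctured p, ¬ InPuncturedChartBall p ε x →
      ∀ v : TangentSpace (𝓡 4) x, 0 ≤ β x ![v, J x v]) :
    0 ≤ T β := by
  by_contra hlt
  push Not at hlt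
  have hs : 0 < T β₀ := h.pos_of_tames hβ₀ hβ₀t
  set t : ℝ := -(T β) / (2 * T β₀) with ht
  have htpos : 0 < t := by
    rw [ht]
    exact div_pos (by linarith) (by linarith)
  have htame : TamesOffBall p ε J (β + t • β₀) := by
    intro x hx v hv
    have h1 := hnn x hx v
    have h2 := hβ₀t x hx v hv
    have h3 : 0 < t * β₀ x ![v, J x v] := mul_pos htpos h2
    simp only [Pi.add_apply, Pi.smul_apply, ContinuousAlternatingMap.add_apply,
      ContinuousAlternatingMap.smul_apply, smul_eq_mul]
    linarith
  have hpos := h.pos_of_tames (hβ.add (hβ₀.smul t)) htame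
  rw [map_add, map_smul, smul_eq_mul, ht] at hpos
  have hcalc : T β + -(T β) / (2 * T β₀) * T β₀ = T β / 2 := by
    field_simp
    ring
  rw [hcalc] at hpos
  linarith

/-- **Domination.** With a smooth taming form `β₀` available, if a smooth form `ω̃` has
`T ω̃ = 0` and dominates the smooth form `α` on `J`-lines off the ball
(`|α_x(v, Jv)| ≤ C ω̃_x(v, Jv)` for `x ∉ B_ε`), then `T α = 0`: both `C ω̃ + α` and
`C ω̃ - α` are `J`-non-negative off the ball. [folklore] -/
theorem tamingWitness_eq_zero_of_dominated (h : TamingWitness p ε J T)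
    {β₀ : MForm (𝓡 4) (punctured p) ℝ 2} (hβ₀ : IsSmoothForm β₀) (hβ₀t : TamesOffBall p ε J β₀)
    {ω' α : MForm (𝓡 4) (punctured p) ℝ 2} (hω' : IsSmoothForm ω') (hα : IsSmoothForm α)
    (hT0 : T ω' = 0) (C : ℝ)
    (hdom : ∀ x : punctured p, ¬ InPuncturedChartBall p ε x →
      ∀ v : TangentSpace (𝓡 4) x, |α x ![v, J x v]| ≤ C * ω' x ![v, J x v]) :
    T α = 0 := by
  have hplus : 0 ≤ T (C • ω' + α) := by
    refine tamingWitness_nonneg_of_forall_nonneg h hβ₀ hβ₀t ((hω'.smul C).add hα) ?_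
    intro x hx v
    have h1 := hdom x hx v
    have h2 := neg_abs_le (α x ![v, J x v])
    simp only [Pi.add_apply, Pi.smul_apply, ContinuousAlternatingMap.add_apply,
      ContinuousAlternatingMap.smul_apply, smul_eq_mul]
    linarith
  have hminus : 0 ≤ T (C • ω' - α) := by
    refine tamingWitness_nonneg_of_forall_nonneg h hβ₀ hβ₀t ((hω'.smul C).add (hα.smul (-1)))
      ?_ |>.trans_eq ?_
    · intro x hx v
      have h1 := hdom x hx v
      have h2 := le_abs_self (α x ![v, J x v])
      simp only [Pi.add_apply, Pi.smul_apply, ContinuousAlternatingMap.add_apply,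
        ContinuousAlternatingMap.smul_apply, smul_eq_mul]
      linarith
    · congr 1
      ext x v
      simp only [Pi.add_apply, Pi.smul_apply, Pi.sub_apply, ContinuousAlternatingMap.add_apply,
        ContinuousAlternatingMap.smul_apply, ContinuousAlternatingMap.sub_apply, smul_eq_mul]
      ring
  rw [map_add, map_smul, hT0, smul_zero, zero_add] at hplus
  rw [map_sub, map_smul, hT0, smul_zero, zero_sub] at hminus
  linarith

end WitnessAlgebra

/-! ### §3 The collar lemma: witnesses do not charge the standard collar (stub `stub_collar`) -/

section Collar

variable {M : Type*} [TopologicalSpace M] [T2Space M] [ChartedSpace (EuclideanSpace ℝ (Fin 4)) M]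
  [IsManifold (𝓡 4) ∞ M]

omit [IsManifold (𝓡 4) ∞ M] in
/-- In the punctured chart-ball, `e x − e p ≠ 0`. [folklore] -/
theorem extChartAt_sub_ne_zero (p : M) {ε : ℝ} {x : punctured p}
    (hx : InPuncturedChartBall p ε x) :
    extChartAt (𝓡 4) p x.1 - extChartAt (𝓡 4) p p ≠ 0 := by
  intro h0
  have h1 : extChartAt (𝓡 4) p x.1 = extChartAt (𝓡 4) p p := sub_eq_zero.1 h0
  have hsrc : x.1 ∈ (extChartAt (𝓡 4) p).source := by
    rw [extChartAt_source]; exact hx.1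
  exact (mem_punctured.1 x.2)
    ((extChartAt (𝓡 4) p).injOn hsrc (mem_extChartAt_source (I := 𝓡 4) p) h1)

omit [IsManifold (𝓡 4) ∞ M] in
/-- In the punctured chart-ball of radius `ρ`, `‖e x − e p‖ < ρ`. [folklore] -/
theorem norm_extChartAt_sub_lt (p : M) {ρ : ℝ} {x : punctured p}
    (hx : InPuncturedChartBall p ρ x) :
    ‖extChartAt (𝓡 4) p x.1 - extChartAt (𝓡 4) p p‖ < ρ := by
  rw [← dist_eq_norm]; exact Metric.mem_ball.1 hx.2

omit [IsManifold (𝓡 4) ∞ M] in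
/-- **Collar lemma.** Let `T` be a taming witness at radius `ε` for `J`, `β₀` a smooth form
taming `J` off `B_ε`, `J` standard on the punctured `ε'`-ball, `ε < ε₃ < ε'`. Suppose given a
smooth closed form `ω̃` standard on `B_ε`, `J`-non-negative, with `ω̃(v, Jv) ≥ c‖A v‖²`
(`c > 0`) on `B_{ε₃}`, and chart-norm bounds for smooth `2`-forms on the collar
`ε ≤ ‖e x − e p‖ ≤ ε₃`. Then `T` kills every smooth `2`-form `α` supported in `B_{ε₃}`:
`T ω̃ = 0` by (W3) and (W1)-closure, and `α` is dominated by `C ω̃` on `J`-lines off `B_ε`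
(`‖De u‖ = ‖e x − e p‖² ‖A u‖`, `A (J v) = J₀ (A v)`), so `T α = 0` by (W1)-closure again
(inside `B_ε` nothing is asked: (W1) only sees the complement of the ball). [folklore] -/
theorem stub_collar (p : M)
    (J : ∀ x : punctured p, TangentSpace (𝓡 4) x →L[ℝ] TangentSpace (𝓡 4) x)
    {ε ε₃ ε' : ℝ} (hε : 0 < ε) (hε₃ : ε < ε₃) (hε₃' : ε₃ < ε')
    (hstd : ∀ x : punctured p, InPuncturedChartBall p ε' x →
        ∀ (v : TangentSpace (𝓡 4) x) (b : EuclideanSpace ℝ (Fin 4)),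
        inner ℝ (fderiv ℝ inversion (extChartAt (𝓡 4) p x.1 - extChartAt (𝓡 4) p p)
          (mfderiv (𝓡 4) 𝓘(ℝ, EuclideanSpace ℝ (Fin 4))
            (fun z : punctured p => extChartAt (𝓡 4) p z.1) x (J x v))) b =
        stdSymplecticForm (fderiv ℝ inversion (extChartAt (𝓡 4) p x.1 - extChartAt (𝓡 4) p p)
          (mfderiv (𝓡 4) 𝓘(ℝ, EuclideanSpace ℝ (Fin 4))
            (fun z : punctured p => extChartAt (𝓡 4) p z.1) x v)) b)
    {T : MForm (𝓡 4) (punctured p) ℝ 2 →ₗ[ℝ] ℝ} (hT : TamingWitness p ε J T)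
    {β₀ : MForm (𝓡 4) (punctured p) ℝ 2} (hβ₀ : IsSmoothForm β₀) (hβ₀t : TamesOffBall p ε J β₀)
    {ω' : MForm (𝓡 4) (punctured p) ℝ 2} (hω's : IsSmoothForm ω') (hω'c : IsClosedForm ω')
    (hω'std : IsStandardOnBall p ε ω')
    (hω'nn : ∀ (x : punctured p) (v : TangentSpace (𝓡 4) x), 0 ≤ ω' x ![v, J x v])
    {c : ℝ} (hc : 0 < c)
    (hω'pos : ∀ x : punctured p, InPuncturedChartBall p ε₃ x → ∀ v : TangentSpace (𝓡 4) x,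
        c * ‖fderiv ℝ inversion (extChartAt (𝓡 4) p x.1 - extChartAt (𝓡 4) p p)
          (mfderiv (𝓡 4) 𝓘(ℝ, EuclideanSpace ℝ (Fin 4))
            (fun z : punctured p => extChartAt (𝓡 4) p z.1) x v)‖ ^ 2 ≤ ω' x ![v, J x v])
    (hbound : ∀ α' : MForm (𝓡 4) (punctured p) ℝ 2, IsSmoothForm α' →
      ∃ C : ℝ, ∀ x : punctured p, x.1 ∈ (chartAt (EuclideanSpace ℝ (Fin 4)) p).source →
        ε ≤ dist (extChartAt (𝓡 4) p x.1) (extChartAt (𝓡 4) p p) →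
        dist (extChartAt (𝓡 4) p x.1) (extChartAt (𝓡 4) p p) ≤ ε₃ →
        ∀ v w : TangentSpace (𝓡 4) x,
          |α' x ![v, w]| ≤ C *
            ‖(show EuclideanSpace ℝ (Fin 4) from mfderiv (𝓡 4) 𝓘(ℝ, EuclideanSpace ℝ (Fin 4))
                (fun z : punctured p => extChartAt (𝓡 4) p z.1) x v)‖ *
            ‖(show EuclideanSpace ℝ (Fin 4) from mfderiv (𝓡 4) 𝓘(ℝ, EuclideanSpace ℝ (Fin 4))
                (fun z : punctured p => extChartAt (𝓡 4) p z.1) x w)‖)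
    {α : MForm (𝓡 4) (punctured p) ℝ 2} (hα : IsSmoothForm α)
    (hα0 : ∀ x : punctured p, ¬ InPuncturedChartBall p ε₃ x → α x = 0) :
    T α = 0 := by
  have hε₃pos : 0 < ε₃ := hε.trans hε₃
  set e := extChartAt (𝓡 4) p with he
  -- `T ω̃ = 0`
  have hTω' : T ω' = 0 :=
    le_antisymm (hT.nonpos_of_standard hω's hω'c hω'std)
      (tamingWitness_nonneg_of_forall_nonneg hT hβ₀ hβ₀t hω's fun x _ v => hω'nn x v)
  -- `α` is dominated by `C ω̃` on `J`-lines off `B_ε`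
  have hJstd : ∀ x : punctured p, InPuncturedChartBall p ε' x → ∀ v : TangentSpace (𝓡 4) x,
      fderiv ℝ inversion (e x.1 - e p)
        (mfderiv (𝓡 4) 𝓘(ℝ, EuclideanSpace ℝ (Fin 4)) (fun z : punctured p => e z.1) x (J x v)) =
      stdComplexStructure (fderiv ℝ inversion (e x.1 - e p)
        (mfderiv (𝓡 4) 𝓘(ℝ, EuclideanSpace ℝ (Fin 4)) (fun z : punctured p => e z.1) x v)) :=
    fun x hx v => eq_stdComplexStructure_of_inner_eq (hstd x hx v)
  obtain ⟨C₀, hC₀⟩ := hbound α hα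
  set C₁ : ℝ := max C₀ 0 with hC₁
  have hC₁nn : 0 ≤ C₁ := le_max_right _ _
  set C : ℝ := C₁ * ε₃ ^ 4 / c with hC
  have hCnn : 0 ≤ C := by positivity
  refine tamingWitness_eq_zero_of_dominated hT hβ₀ hβ₀t hω's hα hTω' C fun x hx v => ?_
  by_cases hx₃ : InPuncturedChartBall p ε₃ x
  · -- in the collar `ε ≤ ‖e x − e p‖ < ε₃`
    have hx' : InPuncturedChartBall p ε' x := hx₃.mono hε₃'.le
    have hy0 : e x.1 - e p ≠ 0 := extChartAt_sub_ne_zero p hx₃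
    have hylt : ‖e x.1 - e p‖ < ε₃ := norm_extChartAt_sub_lt p hx₃
    have hdist_ge : ε ≤ dist (e x.1) (e p) := by
      by_contra hlt
      exact hx ⟨hx₃.1, Metric.mem_ball.2 (lt_of_not_ge hlt)⟩
    -- the chart-norm bound
    set a : EuclideanSpace ℝ (Fin 4) := fderiv ℝ inversion (e x.1 - e p)
      (mfderiv (𝓡 4) 𝓘(ℝ, EuclideanSpace ℝ (Fin 4)) (fun z : punctured p => e z.1) x v) with ha
    have hb := hC₀ x hx₃.1 hdist_ge (by rw [dist_eq_norm]; exact hylt.le) v (J x v)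
    -- `‖De u‖ = ‖y‖² ‖A u‖ ≤ ε₃² ‖A u‖`
    have hDe : ∀ u : TangentSpace (𝓡 4) x,
        ‖(show EuclideanSpace ℝ (Fin 4) from
          mfderiv (𝓡 4) 𝓘(ℝ, EuclideanSpace ℝ (Fin 4)) (fun z : punctured p => e z.1) x u)‖ =
        ‖e x.1 - e p‖ ^ 2 * ‖fderiv ℝ inversion (e x.1 - e p)
          (mfderiv (𝓡 4) 𝓘(ℝ, EuclideanSpace ℝ (Fin 4)) (fun z : punctured p => e z.1) x u)‖ := by
      intro u
      rw [norm_fderiv_inversion_apply hy0]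
      have hpos : 0 < ‖e x.1 - e p‖ ^ 2 := by positivity
      field_simp
    have hDev : ‖(show EuclideanSpace ℝ (Fin 4) from
          mfderiv (𝓡 4) 𝓘(ℝ, EuclideanSpace ℝ (Fin 4)) (fun z : punctured p => e z.1) x v)‖ ≤
        ε₃ ^ 2 * ‖a‖ := by
      rw [hDe v, ha]
      gcongr
    have hDeJv : ‖(show EuclideanSpace ℝ (Fin 4) from
          mfderiv (𝓡 4) 𝓘(ℝ, EuclideanSpace ℝ (Fin 4)) (fun z : punctured p => e z.1) x (J x v))‖ ≤
        ε₃ ^ 2 * ‖a‖ := by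
      rw [hDe (J x v), hJstd x hx' v, norm_stdComplexStructure, ha]
      gcongr
    have hpos := hω'pos x hx₃ v
    rw [← ha] at hpos
    have h1 : |α x ![v, J x v]| ≤ C₁ * (ε₃ ^ 2 * ‖a‖) * (ε₃ ^ 2 * ‖a‖) := by
      refine hb.trans ?_
      have hC₀le : C₀ ≤ C₁ := le_max_left _ _
      have hn1 := norm_nonneg (show EuclideanSpace ℝ (Fin 4) from
          mfderiv (𝓡 4) 𝓘(ℝ, EuclideanSpace ℝ (Fin 4)) (fun z : punctured p => e z.1) x v)
      have hn2 := norm_nonneg (show EuclideanSpace ℝ (Fin 4) from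
          mfderiv (𝓡 4) 𝓘(ℝ, EuclideanSpace ℝ (Fin 4)) (fun z : punctured p => e z.1) x (J x v))
      calc C₀ * _ * _ ≤ C₁ * _ * _ := by gcongr
        _ ≤ C₁ * (ε₃ ^ 2 * ‖a‖) * (ε₃ ^ 2 * ‖a‖) := by gcongr
    have h2 : C₁ * (ε₃ ^ 2 * ‖a‖) * (ε₃ ^ 2 * ‖a‖) = C * (c * ‖a‖ ^ 2) := by
      rw [hC]
      field_simp
    rw [h2] at h1
    exact h1.trans (mul_le_mul_of_nonneg_left hpos hCnn)
  · -- outside `B_{ε₃}` the form vanishes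
    rw [hα0 x hx₃, ContinuousAlternatingMap.coe_zero, Pi.zero_apply, abs_zero]
    exact mul_nonneg hCnn (hω'nn x v)

end Collar

/-! ### §4 API: the standardness clause as `A (J v) = J₀ (A v)` -/

section StandardClause

variable {M : Type*} [TopologicalSpace M] [ChartedSpace (EuclideanSpace ℝ (Fin 4)) M] [T1Space M]

/-- **The standardness clause of route SullivanDual, solved for `J`.** If `J` is standard on the
punctured `ε'`-chart-ball at `p` in the route's inner-product form
`⟪A (J v), b⟫ = ω₀(A v, b)` for all `b` (`A = Dι(e x − e p) ∘ De_x`), then `A (J v) = J₀ (A v)`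
there (`J₀ = stdComplexStructure`, `⟪J₀ a, b⟫ = ω₀(a, b)`): `J` is the pull-back of `J₀` along
the inverted recentred chart. (Used inline in `stub_collar` and the collar form; recorded as API
for the sibling lines of `WitnessCharge` / `HyperbolicEnd`, whose items carry the same clause.)
[folklore] -/
theorem apply_J_eq_stdComplexStructure_of_standard (p : M)
    (J : ∀ x : punctured p, TangentSpace (𝓡 4) x →L[ℝ] TangentSpace (𝓡 4) x) {ε' : ℝ}
    (hstd : ∀ x : punctured p, InPuncturedChartBall p ε' x →
        ∀ (v : TangentSpace (𝓡 4) x) (b : EuclideanSpace ℝ (Fin 4)),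
        inner ℝ (fderiv ℝ inversion (extChartAt (𝓡 4) p x.1 - extChartAt (𝓡 4) p p)
          (mfderiv (𝓡 4) 𝓘(ℝ, EuclideanSpace ℝ (Fin 4))
            (fun z : punctured p => extChartAt (𝓡 4) p z.1) x (J x v))) b =
        stdSymplecticForm (fderiv ℝ inversion (extChartAt (𝓡 4) p x.1 - extChartAt (𝓡 4) p p)
          (mfderiv (𝓡 4) 𝓘(ℝ, EuclideanSpace ℝ (Fin 4))
            (fun z : punctured p => extChartAt (𝓡 4) p z.1) x v)) b)
    {x : punctured p} (hx : InPuncturedChartBall p ε' x) (v : TangentSpace (𝓡 4) x) :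
    fderiv ℝ inversion (extChartAt (𝓡 4) p x.1 - extChartAt (𝓡 4) p p)
        (mfderiv (𝓡 4) 𝓘(ℝ, EuclideanSpace ℝ (Fin 4))
          (fun z : punctured p => extChartAt (𝓡 4) p z.1) x (J x v)) =
      stdComplexStructure (fderiv ℝ inversion (extChartAt (𝓡 4) p x.1 - extChartAt (𝓡 4) p p)
        (mfderiv (𝓡 4) 𝓘(ℝ, EuclideanSpace ℝ (Fin 4))
          (fun z : punctured p => extChartAt (𝓡 4) p z.1) x v)) :=
  eq_stdComplexStructure_of_inner_eq (hstd x hx v)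

/-- In particular `ω₀(A v, A (J v)) = ‖A v‖²` for `J` standard on the ball: the model form
`ι^*ω₀` (through the chart) tames a standard `J` there, with the exact constant. [folklore] -/
theorem stdSymplecticForm_apply_J_of_standard (p : M)
    (J : ∀ x : punctured p, TangentSpace (𝓡 4) x →L[ℝ] TangentSpace (𝓡 4) x) {ε' : ℝ}
    (hstd : ∀ x : punctured p, InPuncturedChartBall p ε' x →
        ∀ (v : TangentSpace (𝓡 4) x) (b : EuclideanSpace ℝ (Fin 4)),
        inner ℝ (fderiv ℝ inversion (extChartAt (𝓡 4) p x.1 - extChartAt (𝓡 4) p p)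
          (mfderiv (𝓡 4) 𝓘(ℝ, EuclideanSpace ℝ (Fin 4))
            (fun z : punctured p => extChartAt (𝓡 4) p z.1) x (J x v))) b =
        stdSymplecticForm (fderiv ℝ inversion (extChartAt (𝓡 4) p x.1 - extChartAt (𝓡 4) p p)
          (mfderiv (𝓡 4) 𝓘(ℝ, EuclideanSpace ℝ (Fin 4))
            (fun z : punctured p => extChartAt (𝓡 4) p z.1) x v)) b)
    {x : punctured p} (hx : InPuncturedChartBall p ε' x) (v : TangentSpace (𝓡 4) x) :
    stdSymplecticForm (fderiv ℝ inversion (extChartAt (𝓡 4) p x.1 - extChartAt (𝓡 4) p p)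
        (mfderiv (𝓡 4) 𝓘(ℝ, EuclideanSpace ℝ (Fin 4))
          (fun z : punctured p => extChartAt (𝓡 4) p z.1) x v))
      (fderiv ℝ inversion (extChartAt (𝓡 4) p x.1 - extChartAt (𝓡 4) p p)
        (mfderiv (𝓡 4) 𝓘(ℝ, EuclideanSpace ℝ (Fin 4))
          (fun z : punctured p => extChartAt (𝓡 4) p z.1) x (J x v))) =
      ‖fderiv ℝ inversion (extChartAt (𝓡 4) p x.1 - extChartAt (𝓡 4) p p)
        (mfderiv (𝓡 4) 𝓘(ℝ, EuclideanSpace ℝ (Fin 4))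
          (fun z : punctured p => extChartAt (𝓡 4) p z.1) x v)‖ ^ 2 := by
  rw [apply_J_eq_stdComplexStructure_of_standard p J hstd hx v,
    stdSymplecticForm_stdComplexStructure_self]

end StandardClause

end SullivanDual

end Summit.SmoothPoincare4.SmoothPoincare4.Theorems

end
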